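import Summits.KontsevichZagierPeriods.KontsevichZagierPeriods.Theses.WeightFloor

/-!
# `StoneDichotomy` (stmt-KontsevichZagierPeriods-12248, route WeightFloor) — proof

`StoneDichotomy : BoundingStonePairs → AbelianStonePairs → SmoothOvalSector`: the smooth-stone layer
of route WeightFloor (two integrand-`1` representations of dimension `2` over smooth stones — compact,
regular closed, non-empty interior, frontier in the smooth real locus of some `p ∈ ℚ[x,y]` — with
equal area are KZ-equivalent) closes from its two cruxes by excluded middle on
"`∃ β : ℝ`, `β` algebraic over `ℚ`, `Area(r) = β·π`": the bounding half `BoundingStonePairs` carries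
this disjunct as an extra hypothesis, the abelian half `AbelianStonePairs` its negation, and all other
hypotheses are shared verbatim. Pure logic over the route's own definitions (one `by_cases`), no new
definitions; planner-proved glue (item docstring: `stoneDichotomy_holds`, 4 lines, in the route's
Sketch.lean), landed by lead c10 of crux stmt-KontsevichZagierPeriods-9129 (banking).
Source: M. Kontsevich, D. Zagier, *Periods* (2001), §1.2.
-/

namespace Summit.KontsevichZagierPeriods.WeightFloor

/-- **`StoneDichotomy`** (route WeightFloor, stmt-KontsevichZagierPeriods-12248):
`BoundingStonePairs → AbelianStonePairs → SmoothOvalSector`, by cases on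
`∃ β : ℝ, IsAlgebraic ℚ β ∧ r.value = β * Real.pi` — the positive case is `BoundingStonePairs`, the
negative case `AbelianStonePairs`, fed with the shared integrand-`1`, smooth-stone and equal-value
hypotheses. [folklore] -/
theorem stoneDichotomy_proof :
    Summit.KontsevichZagierPeriods.KontsevichZagierPeriods.Theses.WeightFloor.StoneDichotomy := by
  intro hB hA r r' h₁ h₁' hs hs' hv
  by_cases h : ∃ β : ℝ, IsAlgebraic ℚ β ∧ r.value = β * Real.pi
  · exact hB r r' h₁ h₁' hs hs' h hv
  · exact hA r r' h₁ h₁' hs hs' h hv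

end Summit.KontsevichZagierPeriods.WeightFloor
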